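import Mathlib
import Summits.ResolutionOfSingularities.ResolutionOfSingularities.Theorems.CleanModels.Negative.CossartPiltant2019Thm15iFrameOrdTowerSteps
import Literature.RingTheory.MvPolynomial.IdealOfVarsBasics
import HarnessLib

/-!
# Towards `OrdTowerShape 5`: the shape facts for the first tower member `S` (roadmap T5-I)

Support lemmas (INPUTS seat res-inputs-p-cp15frame g1, 2026-08-28) for the residual hypothesis `OrdTowerShape 5` of
`CossartPiltant2019_thm_1_5_i_frame_false_of_ordTowerShape` (crux `CleanModels`, stmt-ResolutionOfSingularities-15917; ROADMAP in
`run/shared/lean/pub/res-hironaka/plan/inputs/p-cp15frame/HANDOFF.md` § g1).  The kind-`S` member of an F-110 tower along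
`O = ord_𝔪` is `B = range (S → K)` (`OrdWitness.locAtCentre_range_eq`, file `…OrdTowerSteps`); here we prove the two
`OrdTowerShape` clauses for it:

* `OrdWitness.le_ord_iff_mem_origin_pow` — the DICTIONARY `n ≤ ord F ⟺ F ∈ (X₀,X₁,X₂)ⁿ` between the tree's monomial order and
  Mathlib's `MvPolynomial.idealOfVars` (`mem_pow_idealOfVars_iff`);
* `OrdWitness.ordVK_eq_expNeg_one_of_kindS` — (a) a regular parameter `t ∈ 𝔪 ∖ 𝔪²` of `S` (seen in `K`) has order EXACTLY `1`:
  `t = a/w` with `w(0) ≠ 0`, and `ord a ≥ 2` would put `a ∈ (X)²`, hence `t ∈ 𝔪²`;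
* `OrdWitness.exists_pow_of_kindS` — (b) residues descend for free: `κ(S) = 𝔽_p` is perfect, indeed `c^p = c`, so a unit `u = a/w`
  is congruent to the constant `e = a(0)/w(0) = e^p` modulo `𝔪`.

Not here: kinds `B♯` (curve blow-ups) and the transitions `S → B♯ → O` (roadmap T2–T4, T5-II).  Nothing here proves or refutes
resolution of singularities in characteristic `p`; [OURS · NEGATIVE-SUPPORT] counted 0.
-/

noncomputable section

set_option linter.dupNamespace false -- mandated namespace of this single-conjunct summit

open MvPolynomial IsLocalRing
open Literature.AlgebraicGeometry.Resolution Literature.AlgebraicGeometry.Resolution.WeightedBlowup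

namespace Summit.ResolutionOfSingularities.ResolutionOfSingularities.Theorems.CleanModels.Negative

namespace OrdWitness

variable (p : ℕ) [hp : Fact p.Prime]

/-! ## 1. The dictionary `ord ≥ n ⟺ ∈ (X)ⁿ` -/

/-- `origin = idealOfVars` (both are the ideal of polynomials without constant term). [folklore] -/
theorem origin_eq_idealOfVars : origin p = MvPolynomial.idealOfVars (Fin 3) (ZMod p) :=
  (Literature.RingTheory.MvPolynomial.idealOfVars_eq_ker_constantCoeff).symm

/-- **`n ≤ ord F ⟺ F ∈ (X₀,X₁,X₂)ⁿ`.** [folklore] -/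
theorem le_ord_iff_mem_origin_pow (F : Poly p) (n : ℕ) : (n : ℕ∞) ≤ ord p F ↔ F ∈ origin p ^ n := by
  rw [origin_eq_idealOfVars, MvPolynomial.mem_pow_idealOfVars_iff, Finsupp.degree_eq_weight_one]
  exact le_monomialOrd_iff (fun _ : Fin 3 => (1 : ℕ)) F n

/-- `ordV F ≤ exp (−n) ⟺ F ∈ (X)ⁿ` for `F ≠ 0`. [folklore] -/
theorem ordV_le_expNeg_iff {F : Poly p} (hF : F ≠ 0) (n : ℕ) : ordV p F ≤ expNeg n ↔ F ∈ origin p ^ n := by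
  obtain ⟨m, hm⟩ := ENat.ne_top_iff_exists.mp (ord_ne_top p hF)
  rw [ordV_eq_expNeg p hF hm.symm, expNeg_le_expNeg, ← le_ord_iff_mem_origin_pow, ← hm]
  exact_mod_cast Iff.rfl

/-! ## 2. The kind-`S` member `B = range (S → K)` -/

/-- The fraction `a/w` of `S` in `K` times `w` is `a`. [folklore] -/
theorem algebraMap_mk'_mul (a : Poly p) (w : (origin p).primeCompl) :
    algebraMap (S p) (K p) (IsLocalization.mk' (S p) a w) * algebraMap (Poly p) (K p) w =
      algebraMap (Poly p) (K p) a := by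
  rw [IsScalarTower.algebraMap_apply (Poly p) (S p) (K p) (w : Poly p),
    IsScalarTower.algebraMap_apply (Poly p) (S p) (K p) a, ← map_mul, IsLocalization.mk'_spec]

/-- The ring homomorphism `𝔽_p[X] → S → range (S → K)`. [folklore] -/
def toRange : Poly p →+* (algebraMap (S p) (K p)).range :=
  (algebraMap (S p) (K p)).rangeRestrict.comp (algebraMap (Poly p) (S p))

/-- `toRange` is the composite `𝔽_p[X] → K` on underlying elements. [folklore] -/
theorem coe_toRange (a : Poly p) : ((toRange p a : (algebraMap (S p) (K p)).range) : K p) = algebraMap (Poly p) (K p) a := by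
  rw [IsScalarTower.algebraMap_apply (Poly p) (S p) (K p) a]
  rfl

/-- `toRange` maps `(X)` into the maximal ideal of `range (S → K)` (domination). [folklore] -/
theorem toRange_mem_maximalIdeal [IsLocalRing (algebraMap (S p) (K p)).range] {a : Poly p} (ha : a ∈ origin p) :
    toRange p a ∈ maximalIdeal (algebraMap (S p) (K p)).range := by
  rw [mem_maximalIdeal_iff_valuation_lt_one (range_le_O p) (locAtCentre_range_eq p), valuation_O_lt_one_iff, coe_toRange,
    ordVK_algebraMap]
  exact ordV_lt_one_of_mem p ha

/-- **Roadmap T5-I (a): a regular parameter of `S` has order exactly `1`.**  For the member `B = range (S → K)`: if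
`t ∈ 𝔪_B ∖ 𝔪_B²` then `ordVK t = exp (−1)`.  Write `t = a/w` (`w(0) ≠ 0`): `t ∈ 𝔪` gives `ord a ≥ 1`; `ord a ≥ 2` would give
`a ∈ (X)²`, whose image lies in `𝔪_B²`, and `1/w` is a unit of `B`. [folklore] -/
theorem ordVK_eq_expNeg_one_of_kindS (B : Subring (K p)) (hB : B = (algebraMap (S p) (K p)).range) [IsLocalRing B] (t : B)
    (ht : t ∈ maximalIdeal B) (ht2 : t ∉ maximalIdeal B ^ 2) : ordVK p (t : K p) = expNeg 1 := by
  subst hB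
  have hdom : ∀ x : (algebraMap (S p) (K p)).range,
      x ∈ maximalIdeal (algebraMap (S p) (K p)).range ↔ ordVK p (x : K p) < 1 := fun x => by
    rw [mem_maximalIdeal_iff_valuation_lt_one (range_le_O p) (locAtCentre_range_eq p) x, valuation_O_lt_one_iff]
  obtain ⟨s, hs⟩ := t.2
  obtain ⟨⟨a, w⟩, hs'⟩ := IsLocalization.mk'_surjective (origin p).primeCompl s
  change IsLocalization.mk' (S p) a w = s at hs'
  have htK : algebraMap (S p) (K p) (IsLocalization.mk' (S p) a w) = (t : K p) := by rw [hs', hs]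
  -- `t = a / w` with `ordVK t = ordV a`
  have htv : ordVK p (t : K p) = ordV p a := by rw [← htK]; exact ordVK_mk' p a w
  have hlt : ordVK p (t : K p) < 1 := (hdom _).mp ht
  have ha0 : a ≠ 0 := by
    rintro rfl
    apply ht2
    have : t = 0 := by
      apply Subtype.ext
      rw [← htK, IsLocalization.mk'_zero, map_zero]
      rfl
    rw [this]; exact zero_mem _
  -- `ord a ≤ 1`: otherwise `t ∈ 𝔪²`
  have hnot2 : ¬ ordV p a ≤ expNeg 2 := by
    intro hle
    apply ht2
    have ha2 : a ∈ origin p ^ 2 := (ordV_le_expNeg_iff p ha0 2).mp hle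
    -- the image of `(X)²` lies in `𝔪²`
    have hmap : Ideal.map (toRange p) (origin p ^ 2) ≤ maximalIdeal (algebraMap (S p) (K p)).range ^ 2 := by
      rw [Ideal.map_pow]
      exact Ideal.pow_right_mono
        (Ideal.map_le_iff_le_comap.mpr fun x hx => Ideal.mem_comap.mpr (toRange_mem_maximalIdeal p hx)) 2
    have hta : toRange p a ∈ maximalIdeal (algebraMap (S p) (K p)).range ^ 2 := hmap (Ideal.mem_map_of_mem _ ha2)
    -- `t = (image of a) · (1/w)`, and `1/w ∈ B`
    have hw1 : ordV p (w : Poly p) = 1 := ordV_eq_one_of_not_mem p w.2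
    have hw0 : algebraMap (Poly p) (K p) w ≠ 0 := by
      intro e
      have := ordVK_algebraMap p (w : Poly p)
      rw [e, map_zero, hw1] at this
      exact zero_ne_one this
    have hwinv : (algebraMap (Poly p) (K p) w)⁻¹ ∈ (algebraMap (S p) (K p)).range := by
      refine ⟨IsLocalization.mk' (S p) 1 w, ?_⟩
      have h1 := algebraMap_mk'_mul p 1 w
      rw [map_one] at h1
      exact eq_inv_of_mul_eq_one_left h1
    have e : t = toRange p a * ⟨(algebraMap (Poly p) (K p) w)⁻¹, hwinv⟩ := by
      apply Subtype.ext
      show (t : K p) = ((toRange p a : (algebraMap (S p) (K p)).range) : K p) * (algebraMap (Poly p) (K p) w)⁻¹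
      rw [coe_toRange, ← htK, eq_mul_inv_iff_mul_eq₀ hw0, algebraMap_mk'_mul]
    rw [e]
    exact Ideal.mul_mem_right _ _ hta
  -- discreteness: `exp (−2) < ordV a < 1`
  obtain ⟨m, hm⟩ := ENat.ne_top_iff_exists.mp (ord_ne_top p ha0)
  have hva : ordV p a = expNeg m := ordV_eq_expNeg p ha0 hm.symm
  rw [htv, hva] at hlt
  rw [hva, expNeg_le_expNeg, not_le] at hnot2
  rw [expNeg_lt_one_iff] at hlt
  rw [htv, hva]
  have : m = 1 := by omega
  rw [this]

/-- **Roadmap T5-I (b): residues of `S` descend for free.**  For the member `B = range (S → K)`, every `u ∈ B` is congruent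
modulo `𝔪` to a `p`-th power of an element of `B`: `u = a/w ≡ c := a(0)/w(0) ∈ 𝔽_p` and `c = c^p`. (The hypotheses `d ∈ O`,
`ord (u − d^p) > 0` of the `OrdTowerShape` clause are not even needed.) [folklore] -/
theorem exists_pow_of_kindS (B : Subring (K p)) (hB : B = (algebraMap (S p) (K p)).range) (u : B) (d : K p)
    (_hd : d ∈ O p) (_h : ordVK p ((u : K p) - d ^ p) < 1) : ∃ e : B, ordVK p ((u : K p) - (e : K p) ^ p) < 1 := by
  subst hB
  obtain ⟨s, hs⟩ := u.2
  obtain ⟨⟨a, w⟩, hs'⟩ := IsLocalization.mk'_surjective (origin p).primeCompl s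
  change IsLocalization.mk' (S p) a w = s at hs'
  have huK : algebraMap (S p) (K p) (IsLocalization.mk' (S p) a w) = (u : K p) := by rw [hs', hs]
  -- the constant `c = a(0) / w(0)`
  have hw0 : constantCoeff (w : Poly p) ≠ 0 := fun e => w.2 e
  set c : ZMod p := constantCoeff a * (constantCoeff (w : Poly p))⁻¹ with hc
  refine ⟨toRange p (C c), ?_⟩
  have hcp : (toRange p (C c) : K p) ^ p = algebraMap (Poly p) (K p) (C c) := by
    rw [coe_toRange, ← map_pow, ← C_pow, ZMod.pow_card]
  rw [hcp]
  -- `(u − c) · w = a − c·w`, a polynomial without constant term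
  have hmem : a - C c * (w : Poly p) ∈ origin p := by
    rw [RingHom.mem_ker, map_sub, map_mul, constantCoeff_C, hc, inv_mul_cancel_right₀ hw0, sub_self]
  have hw1 : ordV p (w : Poly p) = 1 := ordV_eq_one_of_not_mem p w.2
  have key : ((u : K p) - algebraMap (Poly p) (K p) (C c)) * algebraMap (Poly p) (K p) w =
      algebraMap (Poly p) (K p) (a - C c * (w : Poly p)) := by
    rw [sub_mul, ← huK, algebraMap_mk'_mul]
    simp only [map_sub, map_mul]
  have hval := congr_arg (ordVK p) key
  rw [map_mul, ordVK_algebraMap, ordVK_algebraMap, hw1, mul_one] at hval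
  rw [hval]
  exact ordV_lt_one_of_mem p hmem

end OrdWitness

end Summit.ResolutionOfSingularities.ResolutionOfSingularities.Theorems.CleanModels.Negative

end
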